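import Literature.NumberTheory.DiophantineGeometry.StewartYuPadicLogFormsReductionProofs
import Summits.ABC.ABC.Theorems.ApproximationBoundRatConsumerSweep

/-!
# Route `LogCardinality`, crux `SubPowerStewartYu` (stmt-ABC-11053): the Yu-2013 clause BY NAME

The closed crux `SubPowerStewartYu` (`log c ≤ κ·rad^{1/3}·exp(−c₀ log rad / log log rad)` for all abc triples)
was proved modulo two INLINED hypotheses; `subPowerStewartYu_of_yu2013`
(`Summits/ABC/ABC/Theorems/ApproximationBoundRatConsumerSweep.lean`, abc-inputs-pr-1, ★ p608796) discharged
the Pasten clause, leaving the anonymous Yu-2013 clause `hYu A` (Stewart 2013, Lemma 5 over `ℚ` in the shape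
`ord_p(∏ αᵢ^{bᵢ} − 1) ≤ Aⁿ · max(p (n/log p)ⁿ, eⁿ log p) · ∏ max(1, h(αᵢ)) · max(log(2 + Σ|bᵢ|), n²)`).
This file supplies that clause, with the concrete constant `A₀ := 10⁵·480`, from the tree's NAMED FACT
`Literature.NumberTheory.DiophantineGeometry.Dioph.Stewart2013_lemma5_rat` (Yu 2013 Main Theorem over `ℚ` in
Stewart's Lemma-5 form; `Literature/NumberTheory/DiophantineGeometry/StewartYuPadicLogForms.lean`) through
its landed uniform consequence `Stewart2013_lemma5_rat.uniform_delta_one`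
(`…/StewartYuPadicLogFormsReductionProofs.lean`):
`ord_p(…) ≤ 10⁵·30ⁿ·n^{5/2}·max(1, log n) · ∏ h(αᵢ) · max(p (n/log p)ⁿ, eⁿ log p) · max(1, log max|bᵢ|)`.
The two bounds share the `max(p (n/log p)ⁿ, eⁿ log p)` factor; the bridge is the three elementary
comparisons (a) `10⁵·30ⁿ·n^{5/2}·max(1, log n) ≤ (10⁵·480)ⁿ` (`n^{5/2}·max(1,log n) ≤ n⁴ ≤ 16ⁿ`,
`10⁵ ≤ (10⁵)ⁿ`), (b) `∏ h(αᵢ) ≤ ∏ max(1, h(αᵢ))`, (c) `max(1, log max|bᵢ|) ≤ max(log(2 + Σ|bᵢ|), n²)`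
(`stewartUniformConstant_le_pow`, `yuClause_of_lemma5Rat`), and the corollary
`subPowerStewartYu_of_lemma5Rat : Stewart2013_lemma5_rat → (sub-power Stewart–Yu for all abc triples)`.

Spec: `pub/abc-inputs/SPEC-I24-BRIDGE.md` (abc-inputs-plan g2, INPUTS-LIST row I-24; host desk g4 D4, 2026-08-28).
PROOF-ONLY file (no definitions, no new named facts, no `sorry`); CONDITIONAL on `Stewart2013_lemma5_rat` AS TYPED
(an XL leaf: Yu 2013 + Stewart 2013 (17)–(18), not proved in the tree). Booking: «LogCardinality sub-power record
(SubPowerStewartYu 11053, closed) = PROVED-MOD-FACT {Stewart2013_lemma5_rat} BY NAME, facts remaining 1».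
HONESTY: abc is not touched (abc moved by 0; NOT abc); typed ≠ proved; PROVED-MOD-FACTS ≠ proved.
-/

-- `Summit.<Summit>.<Problem>` is the mandated summit-side namespace (CONVENTIONS §2); for the
-- single-conjunct summit `ABC` the two coincide, so the duplicate `ABC.ABC` is deliberate.
set_option linter.dupNamespace false

namespace Summit.ABC.ABC.Theorems

open Finset
open Literature.NumberTheory.DiophantineGeometry

/-- (a) The constant comparison: `10⁵ · 30ⁿ · n^{5/2} · max(1, log n) ≤ (10⁵ · 480)ⁿ` for `n ≥ 1`
(`n^{5/2} ≤ n³`, `max(1, log n) ≤ n`, `n⁴ ≤ (2ⁿ)⁴ = 16ⁿ`, `30ⁿ·16ⁿ = 480ⁿ`, `10⁵ ≤ (10⁵)ⁿ`). [folklore] -/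
theorem stewartUniformConstant_le_pow {n : ℕ} (hn : 1 ≤ n) :
    (10 : ℝ) ^ 5 * 30 ^ n * (n : ℝ) ^ ((5 : ℝ) / 2) * max 1 (Real.log n) ≤ (10 ^ 5 * 480) ^ n := by
  have hn1 : (1 : ℝ) ≤ n := by exact_mod_cast hn
  have hn0 : (0 : ℝ) < n := by positivity
  have h1 : (n : ℝ) ^ ((5 : ℝ) / 2) ≤ (n : ℝ) ^ 3 := by
    have := Real.rpow_le_rpow_of_exponent_le hn1 (show (5 : ℝ) / 2 ≤ ((3 : ℕ) : ℝ) by norm_num)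
    rwa [Real.rpow_natCast] at this
  have h2 : max 1 (Real.log n) ≤ n := by
    refine max_le hn1 ?_
    have := Real.log_le_sub_one_of_pos hn0
    linarith
  have h3 : (n : ℝ) ≤ 2 ^ n := by exact_mod_cast (Nat.lt_two_pow_self (n := n)).le
  have h4 : (n : ℝ) ^ 4 ≤ 16 ^ n := by
    calc (n : ℝ) ^ 4 ≤ (2 ^ n) ^ 4 := by gcongr
      _ = 16 ^ n := by rw [← pow_mul, mul_comm, pow_mul]; norm_num
  have h5 : (10 : ℝ) ^ 5 ≤ (10 ^ 5) ^ n := le_self_pow₀ (by norm_num) (by omega)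
  have h0 : 0 ≤ max 1 (Real.log n) := le_max_of_le_left zero_le_one
  calc (10 : ℝ) ^ 5 * 30 ^ n * (n : ℝ) ^ ((5 : ℝ) / 2) * max 1 (Real.log n)
      ≤ (10 ^ 5) ^ n * 30 ^ n * (n : ℝ) ^ 3 * n := by gcongr
    _ = (10 ^ 5) ^ n * 30 ^ n * (n : ℝ) ^ 4 := by ring
    _ ≤ (10 ^ 5) ^ n * 30 ^ n * 16 ^ n := by gcongr
    _ = (10 ^ 5 * 480) ^ n := by
        rw [show (480 : ℝ) = 30 * 16 by norm_num, mul_pow, mul_pow]; ring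

/-- **The Yu-2013 clause of `SubPowerStewartYu` from the named fact `Stewart2013_lemma5_rat`, with `A₀ = 10⁵·480`.**
The conclusion is VERBATIM the antecedent `hYu A` of `subPowerStewartYu_of_yu2013` at `A = 10 ^ 5 * 480`:
for `n ≥ 1`, a prime `p ≥ 5`, `p`-adic units `α₁,…,αₙ ∈ ℚˣ` multiplicatively independent and `b ≠ 0`,
`ord_p(∏ αᵢ^{bᵢ} − 1) ≤ A₀ⁿ · max(p (n/log p)ⁿ, eⁿ log p) · ∏ max(1, h(αᵢ)) · max(log(2 + Σ|bᵢ|), n²)`.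
Proof: `Stewart2013_lemma5_rat.uniform_delta_one` and the comparisons (a) `stewartUniformConstant_le_pow`,
(b) `∏ h(αᵢ) ≤ ∏ max(1, h(αᵢ))`, (c) `max(1, log max|bᵢ|) ≤ max(log(2 + Σ|bᵢ|), n²)` (`max|bᵢ| ≤ Σ|bᵢ|`, `1 ≤ n²`).
[cite: Stewart2013, Lemma 5 (arXiv:1008.1274 p. 8)] -/
theorem yuClause_of_lemma5Rat (h : Literature.NumberTheory.DiophantineGeometry.Dioph.Stewart2013_lemma5_rat) :
    ∀ (n p : ℕ) (α : Fin n → ℚ) (b : Fin n → ℤ), 1 ≤ n → p.Prime → 5 ≤ p →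
      (∀ i, α i ≠ 0 ∧ padicValRat p (α i) = 0) → (∀ e : Fin n → ℤ, ∏ i, α i ^ e i = 1 → e = 0) → b ≠ 0 →
      (padicValRat p (∏ i, α i ^ b i - 1) : ℝ) ≤
        ((10 : ℝ) ^ 5 * 480) ^ n * max ((p : ℝ) * ((n : ℝ) / Real.log p) ^ n) (Real.exp n * Real.log p) *
          (∏ i, max 1 (Height.logHeight₁ (α i))) * max (Real.log (2 + ∑ i, |(b i : ℝ)|)) ((n : ℝ) ^ 2) := by
  intro n p α b hn hp hp5 hα hind hb
  have hE := Dioph.Stewart2013_lemma5_rat.uniform_delta_one h n p α b hp hp5 hα hind hb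
  set M := max ((p : ℝ) * ((n : ℝ) / Real.log p) ^ n) (Real.exp n * Real.log p) with hM
  set H := ∏ i, Height.logHeight₁ (α i) with hH
  set H' := ∏ i, max 1 (Height.logHeight₁ (α i)) with hH'
  set L := max 1 (Real.log ((univ.sup fun i => (b i).natAbs : ℕ) : ℝ)) with hL
  set L' := max (Real.log (2 + ∑ i, |(b i : ℝ)|)) ((n : ℝ) ^ 2) with hL'
  set C := (10 : ℝ) ^ 5 * 30 ^ n * (n : ℝ) ^ ((5 : ℝ) / 2) * max 1 (Real.log n) with hC
  have hCA : C ≤ ((10 : ℝ) ^ 5 * 480) ^ n := stewartUniformConstant_le_pow hn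
  have hA0 : 0 ≤ ((10 : ℝ) ^ 5 * 480) ^ n := by positivity
  have hH0 : 0 ≤ H := Finset.prod_nonneg fun i _ => Height.zero_le_logHeight₁ _
  have hHH' : H ≤ H' :=
    Finset.prod_le_prod (fun i _ => Height.zero_le_logHeight₁ _) fun i _ => le_max_right _ _
  have hH'0 : 0 ≤ H' := hH0.trans hHH'
  have hM0 : 0 ≤ M := by
    refine le_max_of_le_right ?_
    have : 0 < Real.log p := Real.log_pos (by exact_mod_cast (show 1 < p by omega))
    positivity
  have hL0 : 0 ≤ L := le_max_of_le_left zero_le_one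
  have hn1 : (1 : ℝ) ≤ n := by exact_mod_cast hn
  have hLL' : L ≤ L' := by
    refine max_le (le_max_of_le_right (by nlinarith)) (le_max_of_le_left ?_)
    have hsum0 : 0 ≤ ∑ i, |(b i : ℝ)| := Finset.sum_nonneg fun i _ => abs_nonneg _
    have hS : ((univ.sup fun i => (b i).natAbs : ℕ) : ℝ) ≤ ∑ i, |(b i : ℝ)| := by
      have h1 : (univ.sup fun i => (b i).natAbs) ≤ ∑ i, (b i).natAbs :=
        Finset.sup_le fun i hi =>
          Finset.single_le_sum (f := fun j => (b j).natAbs) (fun j _ => Nat.zero_le _) hi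
      calc ((univ.sup fun i => (b i).natAbs : ℕ) : ℝ) ≤ ((∑ i, (b i).natAbs : ℕ) : ℝ) := by
            exact_mod_cast h1
        _ = ∑ i, |(b i : ℝ)| := by push_cast; simp
    rcases (Nat.cast_nonneg (α := ℝ) (univ.sup fun i => (b i).natAbs)).eq_or_lt with h0 | hpos
    · rw [← h0, Real.log_zero]
      exact Real.log_nonneg (by linarith)
    · exact Real.log_le_log hpos (by linarith)
  calc (padicValRat p (∏ i, α i ^ b i - 1) : ℝ) ≤ C * H * M * L := hE
    _ ≤ ((10 : ℝ) ^ 5 * 480) ^ n * H' * M * L' := by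
        have s1 : C * H ≤ ((10 : ℝ) ^ 5 * 480) ^ n * H' := mul_le_mul hCA hHH' hH0 hA0
        have s2 : C * H * M ≤ ((10 : ℝ) ^ 5 * 480) ^ n * H' * M := mul_le_mul_of_nonneg_right s1 hM0
        exact mul_le_mul s2 hLL' hL0 (by positivity)
    _ = ((10 : ℝ) ^ 5 * 480) ^ n * M * H' * L' := by ring

/-- **Sub-power Stewart–Yu for all abc triples, modulo the NAMED FACT `Stewart2013_lemma5_rat` alone**
(Yu 2013 Main Theorem over `ℚ` in Stewart 2013's Lemma-5 form): there are `c₀ > 0`, `κ`, `R₀` with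
`log c ≤ κ · rad(abc)^{1/3} · exp(−c₀ log rad / log log rad)` for every abc triple with `rad ≥ R₀` —
`subPowerStewartYu_of_yu2013` at `A₀ = 10⁵·480` and `yuClause_of_lemma5Rat`. The closed crux
`LogCardinality.SubPowerStewartYu` (stmt-ABC-11053) is thus a theorem modulo exactly this one audited named
fact (facts remaining 1). [cite: StewartYu2001, Theorem 1] [cite: Stewart2013, Lemma 5 and Lemma 8] -/
theorem subPowerStewartYu_of_lemma5Rat
    (h : Literature.NumberTheory.DiophantineGeometry.Dioph.Stewart2013_lemma5_rat) :
    ∃ c₀ : ℝ, 0 < c₀ ∧ ∃ κ R₀ : ℝ, ∀ a b c : ℕ, Literature.NumberTheory.DiophantineGeometry.IsABCTriple a b c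
      → R₀ ≤ (Literature.NumberTheory.DiophantineGeometry.rad a b c : ℝ) → Real.log c ≤ κ *
      (Literature.NumberTheory.DiophantineGeometry.rad a b c : ℝ) ^ (1 / 3 : ℝ) * Real.exp (-(c₀ * Real.log
      (Literature.NumberTheory.DiophantineGeometry.rad a b c : ℝ) / Real.log (Real.log
      (Literature.NumberTheory.DiophantineGeometry.rad a b c : ℝ)))) :=
  subPowerStewartYu_of_yu2013 _ (yuClause_of_lemma5Rat h)

end Summit.ABC.ABC.Theorems
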